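import Summits.Ventures.HSemireg.HomComplexSigma
import Literature.AlgebraicGeometry.HodgeTheory.HomComplexPushforward
import HarnessLib

/-!
# Venture HSemireg — `𝓗om•(K, –) ⋙ ε_*• ≅ ε_*• ⋙ 𝓗om•(ε_*• K, –)` as a SHIFT-COMPATIBLE natural isomorphism
# (piece (N1), functor part, of `HomComplex.IsISemiregularC.of_schemeIso`)

research route conditional on HC_CM; not a corollary; Q11.4-sentence-2 already refuted in dim ≥ 3.

HONEST FRAMING. Kernel bookkeeping on the cell's real carriers (t-7's internal Hom complex `homComplex`, its endofunctor form
`HomComplex.homFunctor Y K = 𝓗om•(K, –)` of `HomComplexSigma.lean`); nothing about any variety; nothing here says HC, HC_CM or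
HC_AV is proved. Seat ring2-b06 gen 119, banked by-name support target `HomComplex.IsISemiregularC.of_schemeIso` of crux
stmt-HodgeConjecture-19787 (ring2 LEAD 152 ruling L152.5 (R3): off the (6,3) critical path). For an isomorphism of schemes
`ε : Y₀ ≅ Y₁` (`ε_* = pushforward ε.hom`, an equivalence of module categories; `ε_*•` = termwise on cochain complexes) and a
cochain complex `K` of `𝒪_{Y₀}`-modules:

* §1 `pushforward_ι_hom_ext` — a morphism out of `ε_*(𝓗om•(K, L)^n)` is determined by its compositions with the
  `ε_*(ι_{q,i})` (`ε_*` preserves the coproduct: the tree's `Literature.Algebra.Homology.mapTotalIso`);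
* §2 `homFunctorPushforwardIsoApp ε K L : ε_*• 𝓗om•(K, L) ≅ 𝓗om•(ε_*• K, ε_*• L)` — the tree's object-level comparison
  `Literature.AlgebraicGeometry.HodgeTheory.homComplexPushforwardIso` (ring2-b06 gen 118) RETYPED onto the venture's `homFunctor`
  (the venture and Literature copies of `homComplex` agree definitionally), its summand formula, and its NATURALITY in `L`
  (`homFunctorPushforwardIsoApp_naturality`: summand by summand the module-level naturality of `ε_* 𝓗om(A, M) ≅ 𝓗om(ε_*A, ε_*M)` in `M`);
* §3 **`homFunctorPushforwardIso ε K : homFunctor Y₀ K ⋙ ε_*• ≅ ε_*• ⋙ homFunctor Y₁ (ε_*• K)`** (`NatIso.ofComponents`) and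
  **`NatTrans.CommShift (homFunctorPushforwardIso ε K).hom ℤ`** for Mathlib's shift structures (`BifunctorShift` first-variable
  shift on `𝓗om•(K, –)`, `Functor.commShiftMapCochainComplex` on `ε_*•`; all of them are identities summand by summand) — this is
  the `τ` consumed by gen 118's `mapShiftedHom_shiftedHomMap` (`DerivedDescentBaseChange.lean`, piece (N3)) to move the middle
  factor `Φ_K = shiftedHomMap (𝓗om•(K, –))` of the cell's `σ_q` across `D(ε_*)`.

References: The Stacks project, *More on Algebra*, Section «Hom complexes» [StacksProject]; C. A. Weibel (1994), §1.2 (1.2.6),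
2.7.4–2.7.5, §10.4 [Weibel1994]; R. Hartshorne (1977), II §5 pp. 109–110 [Hartshorne1977]. Bookkeeping along an isomorphism
(reading; no printed statement is typed verbatim).
-/

noncomputable section

-- `TopCat.Presheaf`/`Scheme.Modules`/`GradedObject` are not reducible.
set_option backward.isDefEq.respectTransparency false

open CategoryTheory CategoryTheory.Category CategoryTheory.Limits AlgebraicGeometry Opposite
open AlgebraicGeometry.Scheme.Modules

universe u

namespace Summit.Ventures.HSemireg

namespace HomComplex

open Literature.AlgebraicGeometry.Modules Literature.Algebra.Homology

variable {Y₀ Y₁ : Scheme.{u}} (ε : Y₀ ≅ Y₁) (K : CochainComplex Y₀.Modules ℤ)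

/-! ## §1 Maps out of `ε_*(𝓗om•(K, L)^n)` -/

/-- The Hom bicomplex `(q, i) ↦ 𝓗om(K^{-i}, L^q)` (venture constants) whose total complex is `homComplex Y K L`.
[cite: StacksProject, More on Algebra, Section «Hom complexes»] -/
abbrev homBicomplexV (Y : Scheme.{u}) (E L : CochainComplex Y.Modules ℤ) :
    HomologicalComplex₂ Y.Modules (ComplexShape.up ℤ) (ComplexShape.up ℤ) :=
  (((sheafHomBifunctor Y).flip.mapBifunctorHomologicalComplex (ComplexShape.up ℤ) (ComplexShape.up ℤ)).obj L).obj
    (dualComplex Y E)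

/-- `homComplex Y E L` is the total complex of `homBicomplexV Y E L` (definitionally).
[cite: StacksProject, More on Algebra, Section «Hom complexes»] -/
theorem homComplex_eq_totalV (Y : Scheme.{u}) (E L : CochainComplex Y.Modules ℤ) :
    homComplex Y E L = (homBicomplexV Y E L).total (ComplexShape.up ℤ) := rfl

/-- `𝓗om•(E, –)` on a chain map is `HomComplex.map` (definitional), degreewise. [folklore] -/
theorem homFunctor_map_f (Y : Scheme.{u}) (E : CochainComplex Y.Modules ℤ) {F F' : CochainComplex Y.Modules ℤ}
    (φ : F ⟶ F') (n : ℤ) : ((homFunctor Y E).map φ).f n = (map Y E φ).f n := rfl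

/-- **A morphism out of `ε_*(𝓗om•(K, L)^n)` is determined by its compositions with the `ε_*(ι_{q,i})`** (`q + i = n`):
`ε_*` preserves the coproduct `∐_{q+i=n} 𝓗om(K^{-i}, L^q)` (`mapTotalIso`). [cite: Weibel1994, §1.2, 1.2.6 and §2.6] -/
theorem pushforward_ι_hom_ext {L : CochainComplex Y₀.Modules ℤ} {n : ℤ} {T : Y₁.Modules}
    {f g : (pushforward ε.hom).obj ((homComplex Y₀ K L).X n) ⟶ T}
    (h : ∀ (q i : ℤ) (hqi : q + i = n),
      (pushforward ε.hom).map (ι Y₀ K L q i n hqi) ≫ f = (pushforward ε.hom).map (ι Y₀ K L q i n hqi) ≫ g) :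
    f = g := by
  rw [← cancel_epi ((mapTotalIso (pushforward ε.hom) (homBicomplexV Y₀ K L) (ComplexShape.up ℤ)).hom.f n)]
  apply HomologicalComplex₂.total.hom_ext
  intro q i hqi
  simp only [← Category.assoc]
  rw [ιTotal_mapTotalIso_hom]
  exact h q i hqi

/-! ## §2 The components and their naturality in `L` -/

/-- **`ε_*• 𝓗om•(K, L) ≅ 𝓗om•(ε_*• K, ε_*• L)`** typed on the venture's `homFunctor` (the tree's
`Literature.AlgebraicGeometry.HodgeTheory.homComplexPushforwardIso`; the two copies of `homComplex` agree definitionally).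
[cite: StacksProject, More on Algebra, Section «Hom complexes»] -/
def homFunctorPushforwardIsoApp (L : CochainComplex Y₀.Modules ℤ) :
    (homFunctor Y₀ K ⋙ (pushforward ε.hom).mapHomologicalComplex (ComplexShape.up ℤ)).obj L ≅
      ((pushforward ε.hom).mapHomologicalComplex (ComplexShape.up ℤ) ⋙
        homFunctor Y₁ (((pushforward ε.hom).mapHomologicalComplex (ComplexShape.up ℤ)).obj K)).obj L :=
  Literature.AlgebraicGeometry.HodgeTheory.homComplexPushforwardIso ε K L

/-- **On summands**: `ε_*(ι_{q,i}) ≫ (iso_L).hom_n = (ε_* 𝓗om(K^{-i}, L^q) ≅ 𝓗om(ε_*K^{-i}, ε_*L^q)).hom ≫ ι'_{q,i}`.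
[cite: StacksProject, More on Algebra, Section «Hom complexes»] -/
theorem map_ι_comp_homFunctorPushforwardIsoApp_hom_f (L : CochainComplex Y₀.Modules ℤ) (q i n : ℤ) (h : q + i = n) :
    (pushforward ε.hom).map (ι Y₀ K L q i n h) ≫ (homFunctorPushforwardIsoApp ε K L).hom.f n =
      (sheafHomPushforwardIso ε (K.X (-i)) (L.X q)).hom ≫
        ι Y₁ (((pushforward ε.hom).mapHomologicalComplex (ComplexShape.up ℤ)).obj K)
          (((pushforward ε.hom).mapHomologicalComplex (ComplexShape.up ℤ)).obj L) q i n h :=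
  Literature.AlgebraicGeometry.HodgeTheory.map_ι_comp_homComplexPushforwardIso_hom_f ε K L q i n h

/-- **Naturality in `L`**: for a chain map `f : L ⟶ L'`, `ε_*•(𝓗om•(K, f)) ≫ iso_{L'} = iso_L ≫ 𝓗om•(ε_*•K, ε_*•f)` — on the
summand `𝓗om(K^{-i}, L^q)` both sides are `ε_*(f^q ∘ –)` followed by the module-level comparison, by its naturality in the second
variable (`pushforward_map_sheafHomMap_comp_comparison`). [cite: Hartshorne1977, II §5 pp. 109–110 (the sheaf Hom and direct images f_*; reading: bookkeeping along an isomorphism of schemes)] -/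
theorem homFunctorPushforwardIsoApp_naturality {L L' : CochainComplex Y₀.Modules ℤ} (f : L ⟶ L') :
    ((pushforward ε.hom).mapHomologicalComplex (ComplexShape.up ℤ)).map ((homFunctor Y₀ K).map f) ≫
        (homFunctorPushforwardIsoApp ε K L').hom =
      (homFunctorPushforwardIsoApp ε K L).hom ≫
        (homFunctor Y₁ (((pushforward ε.hom).mapHomologicalComplex (ComplexShape.up ℤ)).obj K)).map
          (((pushforward ε.hom).mapHomologicalComplex (ComplexShape.up ℤ)).map f) := by
  refine HomologicalComplex.hom_ext _ _ fun n => pushforward_ι_hom_ext ε K fun q i hqi => ?_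
  rw [HomologicalComplex.comp_f, HomologicalComplex.comp_f, Functor.mapHomologicalComplex_map_f,
    ← Functor.map_comp_assoc]
  change (pushforward ε.hom).map (ι Y₀ K L q i n hqi ≫ (map Y₀ K f).f n) ≫ _ =
    _ ≫ _ ≫ (map Y₁ _ (((pushforward ε.hom).mapHomologicalComplex (ComplexShape.up ℤ)).map f)).f n
  rw [ι_map, Functor.map_comp_assoc, map_ι_comp_homFunctorPushforwardIsoApp_hom_f,
    reassoc_of% (map_ι_comp_homFunctorPushforwardIsoApp_hom_f ε K L q i n hqi), ι_map,
    Functor.mapHomologicalComplex_map_f, sheafHomPushforwardIso_hom, sheafHomPushforwardIso_hom]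
  erw [← Category.assoc, pushforward_map_sheafHomMap_comp_comparison ε.hom (K.X (-i)) (f.f q), Category.assoc]

/-! ## §3 The natural isomorphism and its compatibility with shifts -/

/-- **`𝓗om•(K, –) ⋙ ε_*• ≅ ε_*• ⋙ 𝓗om•(ε_*• K, –)`** as functors `CochainComplex (Mod 𝒪_{Y₀}) ⥤ CochainComplex (Mod 𝒪_{Y₁})`.
[cite: StacksProject, More on Algebra, Section «Hom complexes»] [cite: Weibel1994, 2.7.4–2.7.5 and §10.4] -/
def homFunctorPushforwardIso :
    homFunctor Y₀ K ⋙ (pushforward ε.hom).mapHomologicalComplex (ComplexShape.up ℤ) ≅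
      (pushforward ε.hom).mapHomologicalComplex (ComplexShape.up ℤ) ⋙
        homFunctor Y₁ (((pushforward ε.hom).mapHomologicalComplex (ComplexShape.up ℤ)).obj K) :=
  NatIso.ofComponents (homFunctorPushforwardIsoApp ε K) (homFunctorPushforwardIsoApp_naturality ε K)

/-- Components of `homFunctorPushforwardIso`. [cite: StacksProject, More on Algebra, Section «Hom complexes»] -/
@[simp]
theorem homFunctorPushforwardIso_hom_app (L : CochainComplex Y₀.Modules ℤ) :
    (homFunctorPushforwardIso ε K).hom.app L = (homFunctorPushforwardIsoApp ε K L).hom := rfl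

/-- Components of the inverse. [cite: StacksProject, More on Algebra, Section «Hom complexes»] -/
@[simp]
theorem homFunctorPushforwardIso_inv_app (L : CochainComplex Y₀.Modules ℤ) :
    (homFunctorPushforwardIso ε K).inv.app L = (homFunctorPushforwardIsoApp ε K L).inv := rfl

/-- The summand computation behind the shift compatibility, left-hand side: on the summand `(p, q)` of `𝓗om•(K, L⟦a⟧)^n`
(`p + q = n`; the summand object is `𝓗om(K^{-q}, L^{p+a})`), `ε_*(ι) ≫ ε_*((𝓗om•(K,–)-shift iso)_n) ≫ (ε_*•-shift iso)_n ≫ (iso_L)_{n+a}`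
is `(ε_* 𝓗om(K^{-q}, L^{p+a}) ≅ 𝓗om(ε_*K^{-q}, ε_*L^{p+a})).hom ≫ ι'_{p+a, q}`. [cite: Weibel1994, §1.2, 1.2.6 and §10.4] -/
theorem shift_comm_summand_lhs (L : CochainComplex Y₀.Modules ℤ) (a p q n : ℤ) (hpq : p + q = n) :
    (pushforward ε.hom).map (ι Y₀ K (L⟦a⟧) p q n hpq) ≫
        (pushforward ε.hom).map ((((homFunctor Y₀ K).commShiftIso a).hom.app L).f n) ≫
          ((((pushforward ε.hom).mapHomologicalComplex (ComplexShape.up ℤ)).commShiftIso a).hom.app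
              ((homFunctor Y₀ K).obj L)).f n ≫
            ((shiftFunctor (HomologicalComplex Y₁.Modules (ComplexShape.up ℤ)) a).map
                (homFunctorPushforwardIsoApp ε K L).hom).f n =
      (sheafHomPushforwardIso ε (K.X (-q)) (L.X (p + a))).hom ≫
        ι Y₁ (((pushforward ε.hom).mapHomologicalComplex (ComplexShape.up ℤ)).obj K)
          (((pushforward ε.hom).mapHomologicalComplex (ComplexShape.up ℤ)).obj L) (p + a) q (n + a) (by omega) := by
  rw [Functor.mapHomologicalComplex_commShiftIso_hom_app_f]
  erw [Category.id_comp, CochainComplex.shiftFunctor_map_f']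
  rw [← Functor.map_comp_assoc]
  erw [Functor.commShiftIso_map₂CochainComplex_flip_hom_app]
  erw [CochainComplex.ι_mapBifunctorShift₁Iso_hom_f L (dualComplex Y₀ K) (sheafHomBifunctor Y₀).flip a p q n hpq
    (p + a) (n + a) rfl rfl]
  simp only [CochainComplex.shiftFunctorObjXIso, HomologicalComplex.XIsoOfEq, eqToIso_refl, Iso.refl_hom,
    Iso.refl_inv, Category.comp_id]
  exact map_ι_comp_homFunctorPushforwardIsoApp_hom_f ε K L (p + a) q (n + a) _

set_option maxHeartbeats 400000 in
/-- The summand computation, right-hand side: `ε_*(ι) ≫ (iso_{L⟦a⟧})_n ≫ 𝓗om•(ε_*•K, (ε_*•-shift iso))_n ≫ ((𝓗om•(ε_*•K,–)-shift iso)_{ε_*•L})_n`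
is the same morphism. [cite: Weibel1994, §1.2, 1.2.6 and §10.4] -/
theorem shift_comm_summand_rhs (L : CochainComplex Y₀.Modules ℤ) (a p q n : ℤ) (hpq : p + q = n) :
    (pushforward ε.hom).map (ι Y₀ K (L⟦a⟧) p q n hpq) ≫
        (homFunctorPushforwardIsoApp ε K (L⟦a⟧)).hom.f n ≫
          ((homFunctor Y₁ (((pushforward ε.hom).mapHomologicalComplex (ComplexShape.up ℤ)).obj K)).map
              ((((pushforward ε.hom).mapHomologicalComplex (ComplexShape.up ℤ)).commShiftIso a).hom.app L)).f n ≫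
            (((homFunctor Y₁ (((pushforward ε.hom).mapHomologicalComplex (ComplexShape.up ℤ)).obj K)).commShiftIso a).hom.app
                (((pushforward ε.hom).mapHomologicalComplex (ComplexShape.up ℤ)).obj L)).f n =
      (sheafHomPushforwardIso ε (K.X (-q)) (L.X (p + a))).hom ≫
        ι Y₁ (((pushforward ε.hom).mapHomologicalComplex (ComplexShape.up ℤ)).obj K)
          (((pushforward ε.hom).mapHomologicalComplex (ComplexShape.up ℤ)).obj L) (p + a) q (n + a) (by omega) := by
  have h1 := map_ι_comp_homFunctorPushforwardIsoApp_hom_f ε K (L⟦a⟧) p q n hpq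
  have h2 := ι_map Y₁ (((pushforward ε.hom).mapHomologicalComplex (ComplexShape.up ℤ)).obj K)
    ((((pushforward ε.hom).mapHomologicalComplex (ComplexShape.up ℤ)).commShiftIso a).hom.app L) p q n hpq
  rw [Functor.mapHomologicalComplex_commShiftIso_hom_app_f, sheafHomMap_id] at h2
  erw [Category.id_comp] at h2
  rw [← Category.assoc, h1, Category.assoc, homFunctor_map_f, ← Category.assoc (ι Y₁ _ _ p q n hpq)]
  erw [h2]
  erw [Functor.commShiftIso_map₂CochainComplex_flip_hom_app]
  erw [CochainComplex.ι_mapBifunctorShift₁Iso_hom_f (((pushforward ε.hom).mapHomologicalComplex (ComplexShape.up ℤ)).obj L)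
    (dualComplex Y₁ (((pushforward ε.hom).mapHomologicalComplex (ComplexShape.up ℤ)).obj K)) (sheafHomBifunctor Y₁).flip
    a p q n hpq (p + a) (n + a) rfl rfl]
  simp only [CochainComplex.shiftFunctorObjXIso, HomologicalComplex.XIsoOfEq, eqToIso_refl, Iso.refl_hom,
    Iso.refl_inv, Category.comp_id]
  rfl

/-- **`homFunctorPushforwardIso` commutes with the shifts** (Mathlib `NatTrans.CommShift`), for the `BifunctorShift` structure on
`𝓗om•(K, –)` and `Functor.commShiftMapCochainComplex` on `ε_*•` (all identities summand by summand).
[cite: Weibel1994, §10.4 (reading: the comparison is one of triangulated functors)] -/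
instance homFunctorPushforwardIso_hom_commShift : NatTrans.CommShift (homFunctorPushforwardIso ε K).hom ℤ where
  shift_comm a := by
    ext L n : 3
    refine pushforward_ι_hom_ext ε K fun p q hpq => ?_
    simp only [NatTrans.comp_app, Functor.whiskerRight_app, Functor.whiskerLeft_app,
      Functor.commShiftIso_comp_hom_app, homFunctorPushforwardIso_hom_app, HomologicalComplex.comp_f,
      Functor.mapHomologicalComplex_map_f, Category.assoc]
    rw [shift_comm_summand_lhs, shift_comm_summand_rhs]

end HomComplex

end Summit.Ventures.HSemireg

end
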